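import Literature.RepresentationTheory.FiniteGroups.GL2ModularPrincipalSeriesCoordTwist
import HarnessLib

/-!
# Frobenius reciprocity into the Bruhat model: a `(B, χ₁ ⊗ χ₂)`-eigenfunctional on a representation induces an
# equivariant map to `Fun_R(Ind_B^{GL₂(F)}(χ₁ ⊗ χ₂))` in Bruhat coordinates

Topic `Literature/RepresentationTheory/FiniteGroups`, namespace `Literature.RepresentationTheory.FiniteGroups.GL2`.
Two definitions (`borelEigenFun`, `frobeniusCoord`) + THEOREMS; no named fact, no instance, no notation, no `sorry`.

Frobenius reciprocity for the coinduced module [SerreLinearRepresentations1977, §7.2 Prop. 21; Brown1982, Ch. III (5.9) /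
(6.2)]: `Hom_G(X, Coind_B^G χ) ≅ Hom_B(X, χ)`.  Concretely, for a representation `ρ` of `GL₂(F)` on an `R`-module `X` and an
`R`-linear functional `λ : X → R` with `λ(ρ(b)x) = χ₁(b₀₀)χ₂(b₁₁)·λ(x)` for `b` in the Borel subgroup, the function
`g ↦ λ(ρ(g)x)` lies in the function model `Fun_R(Ind_B^G(χ₁ ⊗ χ₂))` (`borelEigenFun_mem`), and

* **`frobeniusCoord χ₁ χ₂ ρ λ hλ : X →ₗ[R] (Option F → R)`** — its Bruhat coordinates (`bruhatEval`);
* `frobeniusCoord_apply_none : frobeniusCoord … x none = λ x` (the coordinate at the identity coset);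
* **`frobeniusCoord_apply_rep`** : `frobeniusCoord (ρ g x) = coordRep χ₁ χ₂ g (frobeniusCoord x)` — EQUIVARIANCE for the
  coordinate model `coordRep χ₁ χ₂` (`GL2ModularPrincipalSeriesLatticeReduction` / `…CoordTwist`);
* `frobeniusCoord_eq_zero_of` : `λ` kills a `ρ`-stable set of vectors ⟹ so does `frobeniusCoord`;
  `frobeniusCoord_ne_zero` : `λ x ≠ 0 ⟹ frobeniusCoord x ≠ 0`.

Consumer: route BSD/TeichmullerTwistDescent (crux `TwistedPeriodLatticeSaturation`): a `(B, ω̃^{−b} ⊗ ω̃ᵇ)`-eigenfunctional on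
the full-level carrier `H₁(Γ₀(M), ℤ_p[GL₂(𝔽_p)])` induces the equivariant functional of the K-line.

## References
* J.-P. Serre, *Linear Representations of Finite Groups* (1977), §7.2 (Prop. 21, Frobenius reciprocity).
  [SerreLinearRepresentations1977]
* K. S. Brown, *Cohomology of Groups* (1982), Ch. III §5 (5.9), §6 Prop. 6.2. [Brown1982]
* D. Bump, *Automorphic Forms and Representations* (1997), §4.1 Eq. (1.6)–(1.7). [Bump1997]
-/

noncomputable section

namespace Literature.RepresentationTheory.FiniteGroups

namespace GL2

open Function

section Frobenius

variable {F : Type} [Field F] [DecidableEq F] {R : Type} [CommRing R] (χ₁ χ₂ : Fˣ →* Rˣ)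
  {X : Type} [AddCommGroup X] [Module R X] (ρ : Representation R (GL (Fin 2) F) X)
  (lam : X →ₗ[R] R) (hlam : ∀ (b : borel F) (x : X), lam (ρ (b : GL (Fin 2) F) x) = (borelCharacter F χ₁ χ₂ b : R) * lam x)

/-- The function `g ↦ λ(ρ(g) x)` on `GL₂(F)` attached to a vector `x` and a functional `λ`.
[cite: SerreLinearRepresentations1977, §7.2 Prop. 21] -/
def borelEigenFun (x : X) : GL (Fin 2) F → R := fun g => lam (ρ g x)

omit [DecidableEq F] in
/-- Unfolding. [cite: SerreLinearRepresentations1977, §7.2 Prop. 21] -/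
@[simp]
theorem borelEigenFun_apply (x : X) (g : GL (Fin 2) F) : borelEigenFun ρ lam x g = lam (ρ g x) := rfl

omit [DecidableEq F] in
include hlam in
/-- For a `(B, χ₁ ⊗ χ₂)`-eigenfunctional `λ`, `g ↦ λ(ρ(g)x)` belongs to `Fun_R(Ind_B^G(χ₁ ⊗ χ₂))`.
[cite: SerreLinearRepresentations1977, §7.2 Prop. 21] -/
theorem borelEigenFun_mem (x : X) :
    borelEigenFun ρ lam x ∈ Representation.coindV (borel F).subtype (scalarRep (borelCharacter F χ₁ χ₂)) := by
  rw [mem_principalSeriesRep_iff]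
  intro b g
  rw [borelEigenFun_apply, borelEigenFun_apply, map_mul, Module.End.mul_apply, hlam]

/-- **Frobenius reciprocity in Bruhat coordinates**: the `R`-linear map `X → (Option F → R)` sending `x` to the Bruhat
coordinates of `g ↦ λ(ρ(g)x)`. [cite: SerreLinearRepresentations1977, §7.2 Prop. 21] [cite: Bump1997, §4.1 Eq. (1.7)] -/
def frobeniusCoord : X →ₗ[R] (Option F → R) where
  toFun x := bruhatEval χ₁ χ₂ ⟨borelEigenFun ρ lam x, borelEigenFun_mem χ₁ χ₂ ρ lam hlam x⟩
  map_add' x y := by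
    funext o
    cases o <;> simp [bruhatEval, map_add]
  map_smul' c x := by
    funext o
    cases o <;> simp [bruhatEval, map_smul]

omit [DecidableEq F] in
/-- The underlying function of the induced element is `g ↦ λ(ρ(g)x)`. [cite: SerreLinearRepresentations1977, §7.2 Prop. 21] -/
theorem frobeniusCoord_apply (x : X) :
    frobeniusCoord χ₁ χ₂ ρ lam hlam x =
      bruhatEval χ₁ χ₂ ⟨borelEigenFun ρ lam x, borelEigenFun_mem χ₁ χ₂ ρ lam hlam x⟩ := rfl

omit [DecidableEq F] in
/-- **The coordinate at the identity coset is `λ` itself**: `frobeniusCoord x none = λ x`.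
[cite: Bump1997, §4.1 Eq. (1.7)] -/
@[simp]
theorem frobeniusCoord_apply_none (x : X) : frobeniusCoord χ₁ χ₂ ρ lam hlam x none = lam x := by
  rw [frobeniusCoord_apply, bruhatEval_none]
  change lam (ρ 1 x) = lam x
  rw [map_one, Module.End.one_apply]

omit [DecidableEq F] in
/-- The big-cell coordinates: `frobeniusCoord x (some t) = λ(ρ(w u(t)) x)`. [cite: Bump1997, §4.1 Eq. (1.7)] -/
@[simp]
theorem frobeniusCoord_apply_some (x : X) (t : F) :
    frobeniusCoord χ₁ χ₂ ρ lam hlam x (some t) = lam (ρ (weyl F * upperUnip F t) x) := by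
  rw [frobeniusCoord_apply, bruhatEval_some]
  rfl

/-- **Equivariance**: `frobeniusCoord (ρ(g) x) = coordRep χ₁ χ₂ g (frobeniusCoord x)` — the induced map intertwines `ρ` with
the coordinate model of `Ind_B^G(χ₁ ⊗ χ₂)` (right translation of functions: `λ(ρ(y)(ρ(g)x)) = λ(ρ(yg)x)`).
[cite: SerreLinearRepresentations1977, §7.2 Prop. 21] [cite: Bump1997, §4.1 Eq. (1.6)] -/
theorem frobeniusCoord_apply_rep (g : GL (Fin 2) F) (x : X) :
    frobeniusCoord χ₁ χ₂ ρ lam hlam (ρ g x) = coordRep χ₁ χ₂ g (frobeniusCoord χ₁ χ₂ ρ lam hlam x) := by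
  rw [frobeniusCoord_apply, frobeniusCoord_apply, coordRep_bruhatEval]
  congr 1
  apply Subtype.ext
  funext y
  rw [principalSeriesRep_apply_coe]
  change lam (ρ y (ρ g x)) = lam (ρ (y * g) x)
  rw [map_mul, Module.End.mul_apply]

omit [DecidableEq F] in
/-- If `λ` kills a `ρ`-stable set of vectors, so does the induced map. [cite: SerreLinearRepresentations1977, §7.2 Prop. 21] -/
theorem frobeniusCoord_eq_zero_of {S : Set X} (hS : ∀ g : GL (Fin 2) F, ∀ x ∈ S, ρ g x ∈ S) (h0 : ∀ x ∈ S, lam x = 0)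
    {x : X} (hx : x ∈ S) : frobeniusCoord χ₁ χ₂ ρ lam hlam x = 0 := by
  funext o
  cases o with
  | none => rw [frobeniusCoord_apply_none, Pi.zero_apply, h0 x hx]
  | some t => rw [frobeniusCoord_apply_some, Pi.zero_apply, h0 _ (hS _ x hx)]

omit [DecidableEq F] in
/-- The induced map does not vanish where `λ` does not. [cite: SerreLinearRepresentations1977, §7.2 Prop. 21] -/
theorem frobeniusCoord_ne_zero {x : X} (hx : lam x ≠ 0) : frobeniusCoord χ₁ χ₂ ρ lam hlam x ≠ 0 := by
  intro h
  apply hx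
  rw [← frobeniusCoord_apply_none χ₁ χ₂ ρ lam hlam x, h, Pi.zero_apply]

end Frobenius

end GL2

end Literature.RepresentationTheory.FiniteGroups
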